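import Summits.RiemannHypothesis.RiemannHypothesis.Theorems.GroundBartaEvenWinsBeyondArchDeflationP72EAssembly
import Summits.RiemannHypothesis.RiemannHypothesis.Theorems.WeilTwoPrimeDeflE72DataR
import Literature.NumberTheory.LFunctions.WeilDeflationPenaltyPolyEval
import HarnessLib

/-!
# RiemannHypothesis / GroundBarta — rung-4 machinery, EVEN sector at `c = 18/25`: the trial vectors' window image (definitions)

Helper file (`--supports stmt-RiemannHypothesis-18085`), RH-free.  Prover B, speedrun unit `sr-gb-rung-b` (gen 5; `cert/even/gen_final_even.py`).
`m72EF` — the window image of the six even trial vectors `m72Ev i = 𝟙·P_i(x/b)` (A-layer file …P72EAssembly); `m72E_mask` identifies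
`𝟙_{[-c,c]}·maskPoly(r_i, 256, 18/25)` (the penalty data `weilCertDeflE72R` of the even-block certificate E72) with `m72Ev i`; `m72EMhi` is the
upper end of the sharp Markov bracket.  Used by prover B's R-layer bridge (…RM72EBridgeA) and by the even Final (…P72EFinal).
-/

set_option linter.dupNamespace false

noncomputable section

open MeasureTheory Set
open scoped BigOperators ComplexConjugate

namespace Summit.RiemannHypothesis.RiemannHypothesis.Theorems.EvenWinsBeyondArch


open Literature.NumberTheory.LFunctions Literature.Analysis.ValidatedNumerics.ExpPoly
open Literature.Analysis.ValidatedNumerics.PolyMP Summit.RiemannHypothesis.RiemannHypothesis.Theorems.EvenWinsBeyondArch.ArchP72E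
open Summit.RiemannHypothesis.RiemannHypothesis.Theorems.OddSector (weilDirichletEnergy₂ weilPoleForm₂)

/-- The penalty list of certificate E72 has six entries. [folklore] -/
theorem m72E_Rlen : weilCertDeflE72R.length = 6 := rfl

set_option maxHeartbeats 0 in
/-- The certificate's masked coefficient vectors are the trimmed data polynomials `P_i` padded with zeros. [folklore] -/
theorem m72E_trim : ∀ i : Fin 6, (List.range 256).map (maskV (weilCertDeflE72R.get (Fin.cast m72E_Rlen.symm i))) =
    m72EP i ++ List.replicate (256 - (m72EP i).length) 0 := by
  decide +kernel

/-- Even parities and non-negative weights of the penalties. [folklore] -/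
theorem m72E_Reven : (∀ i : Fin weilCertDeflE72R.length, (weilCertDeflE72R.get i).2.1 % 2 = 0) ∧
    (∀ i : Fin weilCertDeflE72R.length, 0 ≤ (weilCertDeflE72R.get i).1) := by
  constructor <;> decide

/-- **The bridge's trial vectors are the A-layer vectors**: `𝟙_{[-c,c]}·maskPoly(r_i, 256, 18/25) = m72Ev i`. [folklore] -/
theorem m72E_mask (i : Fin 6) (x : ℝ) :
    (((Icc (-(18 / 25 : ℝ)) (18 / 25)).indicator (fun x ↦ maskPoly (weilCertDeflE72R.get (Fin.cast m72E_Rlen.symm i)) 256 (18 / 25) x) x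
        : ℝ) : ℂ) = m72Ev i x := by
  unfold m72Ev
  rw [dt_wY_apply]
  push_cast
  congr 1
  by_cases hx : x ∈ Icc (-(18 / 25 : ℝ)) (18 / 25)
  · rw [indicator_of_mem hx, indicator_of_mem (by simpa using hx), maskPoly_eq_poly_eval_of_trim _ _ (m72E_trim i)]
  · rw [indicator_of_notMem hx, indicator_of_notMem (by simpa using hx)]

/-- The window image of `v_i` at `c = 18/25` (the bridge's `F_i`, stated for `m72Ev`). [folklore] -/
def m72EF (i : Fin 6) (y : ℝ) : ℂ :=
  (Icc (-(18 / 25 : ℝ)) (18 / 25)).indicator (fun y ↦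
      2 * (∫ x, m72Ev i x * (Real.cosh (x / 2) : ℂ)) * (Real.cosh (y / 2) : ℂ) -
        2 * (∫ x, m72Ev i x * (Real.sinh (x / 2) : ℂ)) * (Real.sinh (y / 2) : ℂ) +
      (∑ m ∈ weilPrimeIndex (18 / 25 : ℝ), (((ArithmeticFunction.vonMangoldt m : ℝ) / Real.sqrt m : ℝ) : ℂ) *
        (2 * m72Ev i y - m72Ev i (y - Real.log m) - m72Ev i (y + Real.log m))) +
      ∫ t in Ioi 0, (weilArchDensity t : ℂ) * (2 * m72Ev i y - m72Ev i (y - t) - m72Ev i (y + t))) y -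
    (weilMarkovConstant (18 / 25 : ℝ) : ℂ) * m72Ev i y

/-- `M_hi`: the certified upper end of the sharp Markov bracket on `(log 2, (log 5)/2]` (`dt_weilMarkovConstant_sharp`). [folklore] -/
def m72EMhi : ℚ := 83141569444492860400 / 10000000000000000000

end Summit.RiemannHypothesis.RiemannHypothesis.Theorems.EvenWinsBeyondArch

end
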